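import Mathlib
import HarnessLib
import HarnessLib.Audit
import Summits.AtomisticToContinuum.FouriersLaw.Theses.HiddenChargeMazur
import Summits.AtomisticToContinuum.FouriersLaw.Theorems.HiddenChargeMazurOddChargeExistsStubOverlapDensityLimit

/-!
# `Lines/birth.lean` — birth skeleton (BC3) for crux `OddChargeExists`
(stmt-AtomisticToContinuum-13511; route `HiddenChargeMazur`, sub-problem `FouriersLaw`, rank 4;
REFUTATION-shaped route, `closes : BridgeGlue → StaticKubo → ThomsonBound → DressedCharge →
OddChargeExists → ¬FouriersLaw`)

Crux (FIXED, concluded below BY NAME):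
`Summit.AtomisticToContinuum.FouriersLaw.Theses.HiddenChargeMazur.OddChargeExists` — at some admissible
parameter point `ω₂, lam, β, γ > 0` and temperature `T > 0` the INFINITE pinned chain carries a finite-range
POLYNOMIAL density `g` (window `{-R,…,R}`), ODD under momentum reversal, with an infinite-chain local
conservation law `𝒜(g∘box_R) = ψ∘box_{R+1} − ψ∘box_{R+1}∘shift` (polynomial flux `ψ`), whose bulk charge
`Q_N = Σ_x g(sites x..x+2R)` has EXTENSIVE static overlap with the total current in the free-end `N`-chain
Gibbs state: `c·N ≤ |∫ J_N·Q_N dGibbs_(N,T)|` for `N ≥ N₀`. The item is DISBELIEVED (the route's kill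
switch); this file is its birth certificate: the typed shape ANY proof must have.

## The line ("exhibit the charge, then pass to the thermodynamic limit"), three registered stubs

Any proof of an `∃`-crux exhibits a witness and verifies its properties; the verification splits into
three different kinds of mathematics, which are the three stubs:

* `stub_oddConservationLaw` (DIFFERENTIAL ALGEBRA in coefficient space — the disbelieved heart, the
  computer-algebra target; size: open): at some `ω₂, lam, β, γ > 0` there is an odd polynomial density `g`
  with a polynomial local conservation law of the infinite pinned chain which is NOT A SHIFT-COBOUNDARY
  (`g ≠ h(sites -R+1..R) − h(sites -R..R-1) + k` for every function `h` of `2R` sites and constant `k`).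
  Purely algebraic: no measure, no temperature, no `N`. Its small-window negation is exactly what the
  refuters' exact nullspace certificates and the landed `NoOddCharge.coboundary_of_conservation`
  (Theorems/HiddenChargeMazurNoOddChargeCoboundary: window 3, degree ≤ 4 ⇒ coboundary) establish; the stub
  lives in the complement of those windows.
* `stub_nonNullOddCharge` (EQUILIBRIUM FLUCTUATION THEORY — "an odd charge that is not a coboundary carries
  current"; size M–L): for all positive parameters, every odd polynomial conserved density that is not a
  shift-coboundary has, at SOME temperature `T > 0`, a current-overlap density `N⁻¹∫ J_N·Q_N dGibbs_(N,T)`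
  that does NOT tend to `0`. (Coboundaries are correctly excluded: `Q_N` telescopes to two boundary terms and
  the overlap is `O(1)` — the analytic half of `NoOddChargeSmallRange`. For a genuine charge the limit density
  is the static current susceptibility `χ(g,T) = Σ_i ⟨j_i · g_0⟩_(∞,T)`, a finite sum by momentum
  independence; by the charge–current sum rule it is `−∂_β ⟨ψ⟩_β` up to normalisation, non-zero unless the
  Gibbs expectation of the flux is temperature-independent. Vacuously true if the expected classification
  "every local conservation law is `c·e_0 +` coboundary `+ k`" holds. CAVEAT recorded honestly: "null" odd
  charges — conserved, not coboundaries, `χ(g,T) = 0` for ALL `T` — do exist in the HARMONIC chain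
  (`lam = β = 0`, outside the stub's range): the basic odd charges `g_k = p_0(q_k − q_{-k})` have
  `χ = −T·C(0)·a^{k-1}(1−a²) ≠ 0`, but the Gaussian correlation ratio `a` is `T`-independent, so the tuned
  combination `a·g_1 − g_2` is null at every temperature; for `lam, β > 0` this exact scaling is broken.)
* `stub_overlapDensityLimit` (1-D EQUILIBRIUM STATISTICAL MECHANICS — thermodynamic limit with free ends;
  TRUE, theorem-grade, size L): for all positive parameters, `T > 0` and every polynomial window density `g`,
  the overlap density `N⁻¹ ∫ J_N·Q_N dGibbs_(N,T)` CONVERGES as `N → ∞` (only the `O(R)` bonds touching a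
  window contribute, by independence of the Gaussian momenta; bulk terms converge to their infinite-volume
  values by uniqueness/clustering of the 1-D transfer-operator Gibbs state with Hilbert–Schmidt kernel;
  uniform moment bounds for the free-end marginals — cf. the landed `NoOddCharge` Gibbs bounds
  `pinnedChain_gibbs_abs_totalCurrent_mul_twoSite_le`, `pinnedChain_integral_bondCurrent_mul_twoSite_eq_zero`).

Composition `OddChargeExists_of` (kernel-checked, no `sorry`): stub 1 gives the parameter point and the
non-coboundary law `(R, g, ψ)`; stub 2 gives a temperature at which the overlap density does not tend to `0`;
stub 3 gives its limit `χ`, hence `χ ≠ 0`; an elementary real-sequence lemma (`extensive_of_tendsto_div`,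
proved here) turns `a_N/N → χ ≠ 0` into `|χ|/2 · N ≤ |a_N|` for `N ≥ N₀` — the crux's extensive overlap.
The seam is liminf-vs-limit: stub 2 alone only bounds a SUBSEQUENCE away from `0`; the crux wants ALL large
`N`, which is exactly what the thermodynamic limit (stub 3) supplies.

Disproof.lean / `Negative/` lemmas for this crux: none on file (`ledger crux ls`: no workfiles,
2026-08-17). Negatives index of the summit (20 refuted statements): none concerns local conservation laws.
Harmonic calibration (`lam = β = 0`, outside every stub's quantifier range): stub 1's body holds there with
the witness `g = p_0 (q_1 − q_{-1})` (odd, window `R = 1`, conserved with a local flux, not a coboundary),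
stub 3 holds there, stub 2's conclusion holds for that witness (`χ = −T·C(0)(1−a²) ≠ 0`; but NOT for every
odd charge — see the null-charge caveat above), and the crux's conclusion `D_N ≍ N` is PROVED there
(`HarmonicChainBallisticFlux`) — the skeleton reproduces the known mechanism exactly where it is known to
operate. If stub 1 were ever witnessed by a NULL charge, the wiring (not the crux) fails at stub 2: re-run
stub 1 for a non-null witness.

## File map
* §1 `Sig.stub_<name> : Prop` — the three stub STATEMENTS (verbatim the theorem types of §2).
* §2 `theorem stub_<name> : <statement> := by sorry` — the registered stubs (the ONLY sorries).
* §3 `extensive_of_tendsto_div` (helper, proved) and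
  `OddChargeExists_of : Sig.stub_oddConservationLaw → Sig.stub_nonNullOddCharge →
  Sig.stub_overlapDensityLimit → OddChargeExists` (proved; the UNIQUE declaration concluding the crux),
  plus a wiring `example` instantiating it through the sorried stubs.
-/

noncomputable section

namespace Summit.AtomisticToContinuum.FouriersLaw.Cruxes.OddChargeExists.Birth

open Summit.AtomisticToContinuum.FouriersLaw.Theses.HiddenChargeMazur (OddChargeExists)

/-! ## §1 The stub statements -/

/-- DIFFERENTIAL ALGEBRA: an odd polynomial local conservation law of the infinite pinned chain that is not
a shift-coboundary exists at some positive parameter point. -/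
def Sig.stub_oddConservationLaw : Prop :=
  ∃ ω₂ lam β γ : ℝ, 0 < ω₂ ∧ 0 < lam ∧ 0 < β ∧ 0 < γ ∧ ∀ P : Literature.MathematicalPhysics.KineticTheory.HeatConduction.OscillatorChain, P = Literature.MathematicalPhysics.KineticTheory.HeatConduction.pinnedChain ω₂ lam β γ → ∃ (R : ℕ) (g : (Fin (2 * R + 1) → ℝ × ℝ) → ℝ) (ψ : (Fin (2 * (R + 1) + 1) → ℝ × ℝ) → ℝ), (∃ p : MvPolynomial (Fin (2 * R + 1) ⊕ Fin (2 * R + 1)) ℝ, ∀ y : Fin (2 * R + 1) → ℝ × ℝ, g y = MvPolynomial.eval (Sum.elim (fun i => (y i).1) (fun i => (y i).2)) p) ∧ (∃ p : MvPolynomial (Fin (2 * (R + 1) + 1) ⊕ Fin (2 * (R + 1) + 1)) ℝ, ∀ y : Fin (2 * (R + 1) + 1) → ℝ × ℝ, ψ y = MvPolynomial.eval (Sum.elim (fun i => (y i).1) (fun i => (y i).2)) p) ∧ (∀ y : Fin (2 * R + 1) → ℝ × ℝ, g (fun i => ((y i).1, -(y i).2)) = -g y) ∧ (∀ σ : ℤ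 → ℝ × ℝ, (∑' x : ℤ, ((σ x).2 * deriv (fun t => g (fun i : Fin (2 * R + 1) => Function.update σ x (t, (σ x).2) ((i : ℤ) - (R : ℕ)))) (σ x).1 + (-deriv P.U (σ x).1 + (deriv P.V ((σ (x + 1)).1 - (σ x).1) - deriv P.V ((σ x).1 - (σ (x - 1)).1))) * deriv (fun t => g (fun i : Fin (2 * R + 1) => Function.update σ x ((σ x).1, t) ((i : ℤ) - (R : ℕ)))) (σ x).2)) = ψ (fun i : Fin (2 * (R + 1) + 1) => σ ((i : ℤ) - (R + 1 : ℕ))) - ψ (fun i : Fin (2 * (R + 1) + 1) => σ ((i : ℤ) - (R + 1 : ℕ) + 1))) ∧ ¬ ∃ (h : (Fin (2 * R) → ℝ × ℝ) → ℝ) (k : ℝ), ∀ y : Fin (2 * R + 1) → ℝ × ℝ, g y = h (fun i : Fin (2 * R) => y i.succ) - h (fun i : Fin (2 * R) => y i.castSucc) + k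

/-- EQUILIBRIUM FLUCTUATIONS: an odd polynomial conserved density that is not a shift-coboundary has, at some
temperature, a current-overlap density not tending to zero. -/
def Sig.stub_nonNullOddCharge : Prop :=
  ∀ ω₂ lam β γ : ℝ, 0 < ω₂ → 0 < lam → 0 < β → 0 < γ → ∀ P : Literature.MathematicalPhysics.KineticTheory.HeatConduction.OscillatorChain, P = Literature.MathematicalPhysics.KineticTheory.HeatConduction.pinnedChain ω₂ lam β γ → ∀ (R : ℕ) (g : (Fin (2 * R + 1) → ℝ × ℝ) → ℝ) (ψ : (Fin (2 * (R + 1) + 1) → ℝ × ℝ) → ℝ), (∃ p : MvPolynomial (Fin (2 * R + 1) ⊕ Fin (2 * R + 1)) ℝ, ∀ y : Fin (2 * R + 1) → ℝ × ℝ, g y = MvPolynomial.eval (Sum.elim (fun i => (y i).1) (fun i => (y i).2)) p) → (∃ p : MvPolynomial (Fin (2 * (R + 1) + 1) ⊕ Fin (2 * (R + 1) + 1)) ℝ, ∀ y : Fin (2 * (R + 1) + 1) → ℝ × ℝ, ψ y = MvPolynomial.eval (Sum.elim (fun i => (y i).1) (fun i => (y i).2)) p) → (∀ y : Fin (2 *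 R + 1) → ℝ × ℝ, g (fun i => ((y i).1, -(y i).2)) = -g y) → (∀ σ : ℤ → ℝ × ℝ, (∑' x : ℤ, ((σ x).2 * deriv (fun t => g (fun i : Fin (2 * R + 1) => Function.update σ x (t, (σ x).2) ((i : ℤ) - (R : ℕ)))) (σ x).1 + (-deriv P.U (σ x).1 + (deriv P.V ((σ (x + 1)).1 - (σ x).1) - deriv P.V ((σ x).1 - (σ (x - 1)).1))) * deriv (fun t => g (fun i : Fin (2 * R + 1) => Function.update σ x ((σ x).1, t) ((i : ℤ) - (R : ℕ)))) (σ x).2)) = ψ (fun i : Fin (2 * (R + 1) + 1) => σ ((i : ℤ) - (R + 1 : ℕ))) - ψ (fun i : Fin (2 * (R + 1) + 1) => σ ((i : ℤ) - (R + 1 : ℕ) + 1))) → (¬ ∃ (h : (Fin (2 * R) → ℝ × ℝ) → ℝ) (k : ℝ), ∀ y : Fin (2 * R + 1) → ℝ × ℝ, g y = h (fun i : Fin (2 * R) => y i.succ) - h (fun i : Fin (2 * R) => y i.castSucc) + k) → ∃ T : ℝ, 0 < T ∧ ¬ Filter.Tendsto (fun N : ℕ => (∫ z, (∑ i : Fin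 N, P.bondCurrent N i z) * (∑ x ∈ Finset.range (N - 2 * R), g (fun i => if h : x + i.val < N then (z.1 ⟨x + i.val, h⟩, z.2 ⟨x + i.val, h⟩) else (0, 0))) ∂(MeasureTheory.volume.tilted fun x => -P.hamiltonian N x / T)) / (N : ℝ)) Filter.atTop (nhds 0)

/-- 1-D STATISTICAL MECHANICS: the thermodynamic limit of the current-overlap density of a polynomial window
density exists (free-end Gibbs states of the pinned anharmonic chain). -/
def Sig.stub_overlapDensityLimit : Prop :=
  ∀ ω₂ lam β γ T : ℝ, 0 < ω₂ → 0 < lam → 0 < β → 0 < γ → 0 < T → ∀ P : Literature.MathematicalPhysics.KineticTheory.HeatConduction.OscillatorChain, P = Literature.MathematicalPhysics.KineticTheory.HeatConduction.pinnedChain ω₂ lam β γ → ∀ (R : ℕ) (g : (Fin (2 * R + 1) → ℝ × ℝ) → ℝ), (∃ p : MvPolynomial (Fin (2 * R + 1) ⊕ Fin (2 * R + 1)) ℝ, ∀ y : Fin (2 * R + 1) → ℝ × ℝ, g y = MvPolynomial.eval (Sum.elim (fun i => (y i).1) (fun i => (y i).2)) p) → ∃ χ : ℝ, Filter.Tendsto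 (fun N : ℕ => (∫ z, (∑ i : Fin N, P.bondCurrent N i z) * (∑ x ∈ Finset.range (N - 2 * R), g (fun i => if h : x + i.val < N then (z.1 ⟨x + i.val, h⟩, z.2 ⟨x + i.val, h⟩) else (0, 0))) ∂(MeasureTheory.volume.tilted fun x => -P.hamiltonian N x / T)) / (N : ℝ)) Filter.atTop (nhds χ)

/-! ## §2 The registered stubs (the only `sorry`s of this file) -/

/-- **STUB 1 — `stub_oddConservationLaw`** (differential algebra; the disbelieved heart; size: open).
At some `ω₂, lam, β, γ > 0` the infinite pinned chain `pinnedChain ω₂ lam β γ` admits a window radius `R`, a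
polynomial density `g` on the `2R+1` sites `{-R,…,R}` and a polynomial flux `ψ` on `2R+3` sites such that
`g` is odd under `p ↦ -p`, the local conservation law `𝒜(g∘box_R) = ψ∘box_{R+1} − ψ∘box_{R+1}∘shift` holds
identically on `(ℝ×ℝ)^ℤ` (verbatim the crux's conservation clause), and `g` is NOT a shift-coboundary plus
constant: there are no `h : (2R sites) → ℝ`, `k : ℝ` with `g(y) = h(y_{-R+1..R}) − h(y_{-R..R-1}) + k`.
Why plausibly true: it is not believed (pinning destroys the harmonic/Toda odd charges; refuter certificates:
no genuine odd class in windows (1,≤5),(2,≤3),(3,≤3) at any positive parameters; landed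
`NoOddCharge.coboundary_of_conservation` settles window 3 / degree ≤ 4) — this is where the line, and the
crux, are expected to die; a witness would be a computer-algebra certificate (explicit coefficients, the law
checked by `ring`/`simp` over the finite window sum, non-coboundary by a linear-algebra obstruction).
Why it might fail: a Levi–Yamilov / NoLocalIntegrals classification (every polynomial local conservation
law of the anharmonic pinned chain is `c·e_0 + (h∘shift − h) + k`; oddness forces `c = k = 0`). -/
theorem stub_oddConservationLaw :
    ∃ ω₂ lam β γ : ℝ, 0 < ω₂ ∧ 0 < lam ∧ 0 < β ∧ 0 < γ ∧ ∀ P : Literature.MathematicalPhysics.KineticTheory.HeatConduction.OscillatorChain, P = Literature.MathematicalPhysics.KineticTheory.HeatConduction.pinnedChain ω₂ lam β γ → ∃ (R : ℕ) (g : (Fin (2 * R + 1) → ℝ × ℝ) → ℝ) (ψ : (Fin (2 * (R + 1) + 1) → ℝ × ℝ) → ℝ), (∃ p : MvPolynomial (Fin (2 * R + 1) ⊕ Fin (2 * R + 1)) ℝ, ∀ y : Fin (2 * R + 1) → ℝ × ℝ, g y = MvPolynomial.eval (Sum.elim (fun i => (y i).1) (fun i => (y i).2)) p) ∧ (∃ p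 : MvPolynomial (Fin (2 * (R + 1) + 1) ⊕ Fin (2 * (R + 1) + 1)) ℝ, ∀ y : Fin (2 * (R + 1) + 1) → ℝ × ℝ, ψ y = MvPolynomial.eval (Sum.elim (fun i => (y i).1) (fun i => (y i).2)) p) ∧ (∀ y : Fin (2 * R + 1) → ℝ × ℝ, g (fun i => ((y i).1, -(y i).2)) = -g y) ∧ (∀ σ : ℤ → ℝ × ℝ, (∑' x : ℤ, ((σ x).2 * deriv (fun t => g (fun i : Fin (2 * R + 1) => Function.update σ x (t, (σ x).2) ((i : ℤ) - (R : ℕ)))) (σ x).1 + (-deriv P.U (σ x).1 + (deriv P.V ((σ (x + 1)).1 - (σ x).1) - deriv P.V ((σ x).1 - (σ (x - 1)).1))) * deriv (fun t => g (fun i : Fin (2 * R + 1) => Function.update σ x ((σ x).1, t) ((i : ℤ) - (R : ℕ)))) (σ x).2)) = ψ (fun i : Fin (2 * (R + 1) + 1) => σ ((i : ℤ) - (R + 1 : ℕ))) - ψ (fun i : Fin (2 * (R + 1) + 1) => σ ((i : ℤ) - (R + 1 : ℕ) + 1))) ∧ ¬ ∃ (h : (Fin (2 * R) → ℝ × ℝ)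 → ℝ) (k : ℝ), ∀ y : Fin (2 * R + 1) → ℝ × ℝ, g y = h (fun i : Fin (2 * R) => y i.succ) - h (fun i : Fin (2 * R) => y i.castSucc) + k := by
  sorry

/-- **STUB 2 — `stub_nonNullOddCharge`** (equilibrium fluctuation theory; size M–L). For all
`ω₂, lam, β, γ > 0`, every `R`, polynomial `g` on `2R+1` sites and polynomial `ψ` on `2R+3` sites with `g` odd,
the infinite-chain conservation law, and `g` NOT a shift-coboundary plus constant: there is a temperature
`T > 0` at which the overlap density `N⁻¹ ∫ J_N·Q_N d(volume.tilted (−H_N/T))` does not tend to `0` as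
`N → ∞` (`J_N = Σ_i bondCurrent`, `Q_N = Σ_{x < N−2R} g(sites x..x+2R)`, verbatim the crux's overlap).
Why plausibly true: the limit density is the static susceptibility `χ(g,T) = Σ_{i=-R-1}^{R} ⟨j_i g_0⟩_(∞,T)`
(finite sum: `⟨j_i g_x⟩ = 0` unless bond `i` touches the window, momenta being independent centred
Gaussians under Gibbs); for a conserved `g` the charge–current sum rule expresses `χ` through the
temperature-derivative of the Gibbs expectation of the (even) flux `ψ`, which vanishes for coboundaries
(`ψ = −𝒜h + k`, `⟨𝒜h⟩ = 0`) and, for `lam, β > 0` (no Gaussian scaling), is not expected to vanish at every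
`T` for a genuine charge; first and foremost, if the expected classification holds the hypothesis is EMPTY
(vacuous truth) — a prover may discharge the stub through `NoLocalIntegrals`-type results as they land.
Why it might fail: a "null" odd charge — conserved, not a coboundary, yet `χ(g,T) = 0` for all `T`. Such
charges DO exist in the harmonic chain `lam = β = 0` (outside the stub's range): the basic odd charges
`g_k = p_0(q_k − q_{-k})` have `χ = −T·C(0)·a^{k-1}(1−a²) ≠ 0` with a `T`-INDEPENDENT Gaussian ratio `a`, so
`a·g_1 − g_2` is null at every `T`; any proof must use `lam > 0 ∨ β > 0` to break that scaling (or the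
emptiness of the hypothesis). -/
theorem stub_nonNullOddCharge :
    ∀ ω₂ lam β γ : ℝ, 0 < ω₂ → 0 < lam → 0 < β → 0 < γ → ∀ P : Literature.MathematicalPhysics.KineticTheory.HeatConduction.OscillatorChain, P = Literature.MathematicalPhysics.KineticTheory.HeatConduction.pinnedChain ω₂ lam β γ → ∀ (R : ℕ) (g : (Fin (2 * R + 1) → ℝ × ℝ) → ℝ) (ψ : (Fin (2 * (R + 1) + 1) → ℝ × ℝ) → ℝ), (∃ p : MvPolynomial (Fin (2 * R + 1) ⊕ Fin (2 * R + 1)) ℝ, ∀ y : Fin (2 * R + 1) → ℝ × ℝ, g y = MvPolynomial.eval (Sum.elim (fun i => (y i).1) (fun i => (y i).2)) p) → (∃ p : MvPolynomial (Fin (2 * (R + 1) + 1) ⊕ Fin (2 * (R + 1) + 1)) ℝ, ∀ y : Fin (2 * (R + 1) + 1) → ℝ × ℝ, ψ y = MvPolynomial.eval (Sum.elim (fun i => (y i).1) (fun i => (y i).2)) p) → (∀ y : Fin (2 * R + 1) → ℝ × ℝ, g (fun i => ((y i).1, -(y i).2)) = -g y) → (∀ σ : ℤ → ℝ × ℝ,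 (∑' x : ℤ, ((σ x).2 * deriv (fun t => g (fun i : Fin (2 * R + 1) => Function.update σ x (t, (σ x).2) ((i : ℤ) - (R : ℕ)))) (σ x).1 + (-deriv P.U (σ x).1 + (deriv P.V ((σ (x + 1)).1 - (σ x).1) - deriv P.V ((σ x).1 - (σ (x - 1)).1))) * deriv (fun t => g (fun i : Fin (2 * R + 1) => Function.update σ x ((σ x).1, t) ((i : ℤ) - (R : ℕ)))) (σ x).2)) = ψ (fun i : Fin (2 * (R + 1) + 1) => σ ((i : ℤ) - (R + 1 : ℕ))) - ψ (fun i : Fin (2 * (R + 1) + 1) => σ ((i : ℤ) - (R + 1 : ℕ) + 1))) → (¬ ∃ (h : (Fin (2 * R) → ℝ × ℝ) → ℝ) (k : ℝ), ∀ y : Fin (2 * R + 1) → ℝ × ℝ, g y = h (fun i : Fin (2 * R) => y i.succ) - h (fun i : Fin (2 * R) => y i.castSucc) + k) → ∃ T : ℝ, 0 < T ∧ ¬ Filter.Tendsto (fun N : ℕ => (∫ z, (∑ i : Fin N, P.bondCurrent N i z) * (∑ x ∈ Finset.range (N - 2 * R), g (fun i => if h : x + i.val < N then (z.1 ⟨x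 + i.val, h⟩, z.2 ⟨x + i.val, h⟩) else (0, 0))) ∂(MeasureTheory.volume.tilted fun x => -P.hamiltonian N x / T)) / (N : ℝ)) Filter.atTop (nhds 0) := by
  sorry

/-- **STUB 3 — `stub_overlapDensityLimit`** — CLOSED 2026-08-17 (stub-worker of the lead, p151000:
`Theorems/HiddenChargeMazurOddChargeExistsStubOverlapDensityLimit{Moments,Window,Cesaro,}.lean`, via the landed
bulk equivalence of ensembles `stub_bulkWindowEquivalence`) (1-D equilibrium statistical mechanics; TRUE, theorem-grade;
size L). For all `ω₂, lam, β, γ, T > 0`, every `R` and every POLYNOMIAL density `g` on `2R+1` sites, the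
current-overlap density `N⁻¹ ∫ J_N·Q_N d(volume.tilted (−H_N/T))` converges as `N → ∞`.
Why true: under the free-end Gibbs state the momenta are i.i.d. centred Gaussians independent of the
positions, and `j_i = −½(p_i + p_{i+1})V'(q_{i+1} − q_i)`, so `∫ j_i·g_x dGibbs = 0` unless bond `i`
touches the window of `g_x` (landed pattern: `NoOddCharge.pinnedChain_integral_bondCurrent_mul_twoSite_eq_zero`);
hence `∫ J_N Q_N = Σ_x Σ_{|i−x| ≤ 2R+1} ⟨j_i g_x⟩_N` has `O(N)` terms, each bounded uniformly in `N`
(superstable moment bounds, cf. `pinnedChain_gibbs_abs_totalCurrent_mul_twoSite_le`), and each bulk term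
converges to its translation-invariant infinite-volume value (uniqueness and exponential clustering of the
1-D Gibbs state: positive Hilbert–Schmidt transfer operator `exp(−[U(q)/2 + V(q'−q) + U(q')/2]/T)` on
`L²(ℝ)`, free boundary conditions); Cesàro then gives the limit `χ(g,T) = Σ_{i=-R-1}^{R} ⟨j_i g_0⟩_(∞,T)`.
Why it might fail: it does not mathematically; the Lean cost is the transfer-operator thermodynamic limit
for unbounded spins (not yet vendored: DLR uniqueness exists in `InfiniteChainShiftInvariantUniqueness`, the
finite-volume-to-DLR convergence with free ends does not). -/
theorem stub_overlapDensityLimit :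
    ∀ ω₂ lam β γ T : ℝ, 0 < ω₂ → 0 < lam → 0 < β → 0 < γ → 0 < T → ∀ P : Literature.MathematicalPhysics.KineticTheory.HeatConduction.OscillatorChain, P = Literature.MathematicalPhysics.KineticTheory.HeatConduction.pinnedChain ω₂ lam β γ → ∀ (R : ℕ) (g : (Fin (2 * R + 1) → ℝ × ℝ) → ℝ), (∃ p : MvPolynomial (Fin (2 * R + 1) ⊕ Fin (2 * R + 1)) ℝ, ∀ y : Fin (2 * R + 1) → ℝ × ℝ, g y = MvPolynomial.eval (Sum.elim (fun i => (y i).1) (fun i => (y i).2)) p) → ∃ χ : ℝ, Filter.Tendsto (fun N : ℕ => (∫ z, (∑ i : Fin N, P.bondCurrent N i z) * (∑ x ∈ Finset.range (N - 2 * R), g (fun i => if h : x + i.val < N then (z.1 ⟨x + i.val, h⟩, z.2 ⟨x + i.val, h⟩) else (0, 0))) ∂(MeasureTheory.volume.tilted fun x => -P.hamiltonian N x / T)) / (N : ℝ)) Filter.atTop (nhds χ) :=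
  Summit.AtomisticToContinuum.FouriersLaw.Theorems.OddChargeExists.stub_overlapDensityLimit

/-! ## §3 The composition: the three stubs give the crux BY NAME (no `sorry` below) -/

/-- Elementary real-sequence lemma (the liminf-vs-limit seam of the line): if `a_N / N → χ ≠ 0` then
`|χ|/2 · N ≤ |a_N|` for all large `N`. [folklore] -/
theorem extensive_of_tendsto_div {a : ℕ → ℝ} {χ : ℝ}
    (h : Filter.Tendsto (fun N : ℕ => a N / (N : ℝ)) Filter.atTop (nhds χ)) (hχ : χ ≠ 0) :
    ∃ c : ℝ, 0 < c ∧ ∃ N₀ : ℕ, ∀ N : ℕ, N₀ ≤ N → c * (N : ℝ) ≤ |a N| := by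
  have hpos : 0 < |χ| / 2 := by positivity
  have hev : ∀ᶠ N : ℕ in Filter.atTop, |χ| / 2 * (N : ℝ) ≤ |a N| := by
    have h1 : ∀ᶠ N : ℕ in Filter.atTop, dist (a N / (N : ℝ)) χ < |χ| / 2 :=
      Metric.tendsto_nhds.mp h _ hpos
    have h2 : ∀ᶠ N : ℕ in Filter.atTop, 1 ≤ N := Filter.eventually_ge_atTop 1
    filter_upwards [h1, h2] with N hN hN1
    have hNpos : (0 : ℝ) < N := by exact_mod_cast hN1
    rw [Real.dist_eq] at hN
    have hlow : |χ| / 2 < |a N / (N : ℝ)| := by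
      have htri := abs_sub_abs_le_abs_sub χ (a N / (N : ℝ))
      rw [abs_sub_comm] at hN
      linarith
    rw [abs_div, abs_of_pos hNpos, lt_div_iff₀ hNpos] at hlow
    exact hlow.le
  obtain ⟨N₀, hN₀⟩ := Filter.eventually_atTop.mp hev
  exact ⟨|χ| / 2, hpos, N₀, hN₀⟩

/-- **`OddChargeExists` from the two open stubs** (stub 3, the thermodynamic limit, is PROVED and discharged
inside: `stub_overlapDensityLimit` above is now the landed theorem). Stub 1 supplies `ω₂, lam, β, γ > 0` and a non-coboundary odd
polynomial conservation law `(R, g, ψ)`; stub 2 a temperature `T > 0` at which the overlap density does not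
tend to `0`; stub 3 its limit `χ`, so `χ ≠ 0`; `extensive_of_tendsto_div` gives `c = |χ|/2` and `N₀`. -/
theorem OddChargeExists_of :
    Sig.stub_oddConservationLaw → Sig.stub_nonNullOddCharge → OddChargeExists := by
  intro h1 h2
  have h3 : Sig.stub_overlapDensityLimit := stub_overlapDensityLimit
  obtain ⟨ω₂, lam, β, γ, hω, hl, hβ, hγ, hlaw⟩ := h1
  obtain ⟨R, g, ψ, hg, hψ, hodd, hcons, hncob⟩ := hlaw _ rfl
  obtain ⟨T, hT, hnn⟩ := h2 ω₂ lam β γ hω hl hβ hγ _ rfl R g ψ hg hψ hodd hcons hncob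
  obtain ⟨χ, hχ⟩ := h3 ω₂ lam β γ T hω hl hβ hγ hT _ rfl R g hg
  have hχ0 : χ ≠ 0 := by
    rintro rfl
    exact hnn hχ
  refine ⟨ω₂, lam, β, γ, T, hω, hl, hβ, hγ, hT, ?_⟩
  rintro P rfl
  exact ⟨R, g, ψ, hg, hψ, hodd, hcons, extensive_of_tendsto_div hχ hχ0⟩

/-- Wiring check: the three registered stubs feed `OddChargeExists_of` exactly as stated (their verbatim
statements are definitionally the `Sig.*` aliases). An `example`, so that `OddChargeExists_of` stays the only
declaration of the file concluding the crux. -/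
example : OddChargeExists :=
  OddChargeExists_of stub_oddConservationLaw stub_nonNullOddCharge

end Summit.AtomisticToContinuum.FouriersLaw.Cruxes.OddChargeExists.Birth

end
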